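import Summits.Ventures.Crystal3D.Theorems.StickyWulffConstantCoaxialWallLawCslLattice
import Summits.Ventures.Crystal3D.Theorems.StickyWulffConstantGenericWallFloorGrainCredits
import HarnessLib

/-!
# Coincidence lines are at most half of the in-plane lines (run tops of a CSL twin's clamped sample)

HONEST FRAMING. Part of the venture `Summits/Ventures/Crystal3D` (cell `crystal3d-full`), helper
`--supports` the crux `CoaxialWallLaw` (stmt-Ventures-19481, `route-Ventures-StickyWulffConstant`),
REGISTERED line `WallLedgerF` (planner cf-p1 gen 16), stub `stub_coaxialTwoSlabAdhesion`
(terrace/riser slot ledger, RIGID rung, CSL case).  Rung infrastructure only.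

CSL twin pair in normal form (`…CslLattice.movedTwin_eq_of_common_point`): `Λ₁ = L·Λ₀ + c`,
`Λ₂ = L·Λ₀⁻ + c`; COINCIDENCE sites `Λ₁ ∩ Λ₂` = the layers `3 ∣ k` of `Λ₁`.  An in-plane bond line
of `Λ₁` lies in one basal layer, so it consists of coincidence sites or of non-coincidence sites.  The
riser count of the twin rung must not credit the coincidence lines (they continue into the other
grain).  This file bounds them WITHOUT a sublattice line count:

**Theorem (`csl_card_tops_le_two_mul_nonCoinc`).**  For the clamped slab sample `P` of `Λ₁`
(`3 ≤ R₀ ≤ ρ`) and an in-plane slot `w` (`w₂ = 0`):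
`#{p ∈ P : p + L w ∉ P} ≤ 2 · #{p ∈ P : p ∉ Λ₂, p + L w ∉ P} + #{rim balls of P}`.
Proof: the shift `p ↦ p ± L vp` (`vp` an out-of-plane slot, sign by the height zone of `p`) moves a
non-rim COINCIDENCE run top into the sample and into an ADJACENT layer (non-coincidence, since
`3 ∤ ±1`); following that line to its run top gives an injection into the non-coincidence run tops
(one top per line by run-convexity; the two signs land in the two different layer classes
`k₀ ± 1`, since `2 vp ∉ Λ₀⁻`).
(The metric corollary with `tops_ge_lineCount` and the rim count is in the next file.)

Also: `mem_twin_iff_three_dvd` (a site `(k,i,j)` of `Λ₀` lies on `Λ₀⁻` iff `3 ∣ k`),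
`inPlane_slot_mem_twin`, `outOfPlane_slot_not_mem_twin` (`v`, `2v ∉ Λ₀⁻`),
`add_map_mem_movedTwin_iff` (shifting a `Λ₂`-site by `L v` stays on `Λ₂` iff `v ∈ Λ₀⁻`).

WHAT THIS IS NOT: the transfer to structured tops of `X`, the CSL grain lemma, the stub; rung F-C1
not moved.
-/

noncomputable section

namespace Summit.Ventures.Crystal3D.Theorems

open Summit.Ventures.Crystal3D Finset
open Literature.MathematicalPhysics.StatisticalMechanics (barlowPos barlowStacking fccStacking
  constHagg haggLabel haggLabel_const barlowPos_mem barlowPos_apply_two)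
open Literature.Barriers.AtomisticToContinuum (barlowAddSubgroupOfConst)
open scoped InnerProductSpace

/-! ## Membership in the twin stacking -/

/-- A site `(k, i, j)` of `Λ₀` lies on the twin stacking `Λ₀⁻` iff `3 ∣ k`. -/
theorem mem_twin_iff_three_dvd (k i j : ℤ) :
    barlowPos 1 (Real.sqrt (2 / 3)) constHagg k i j ∈
        barlowStacking 1 (Real.sqrt (2 / 3)) (fun _ : ℤ => (-1 : ℤ)) ↔ (3 : ℤ) ∣ k := by
  refine ⟨fun h => ?_, fun h => barlowPos_const_mem_twin_of_dvd h i j⟩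
  obtain ⟨k', i', j', hkij⟩ := h
  have h12 := twelve_mul_dist_sq_fcc_twin k i j k' i' j'
  rw [← hkij, dist_self] at h12
  norm_num at h12
  have hZ : (3 * (2 * (i - i') + (j - j') + (k + k')) ^ 2 + (3 * (j - j') + (k + k')) ^ 2 +
      8 * (k - k') ^ 2 : ℤ) = 0 := by exact_mod_cast h12.symm
  have h1 : (k - k') ^ 2 = 0 := by
    nlinarith [sq_nonneg (2 * (i - i') + (j - j') + (k + k')), sq_nonneg (3 * (j - j') + (k + k')),
      sq_nonneg (k - k')]
  have h2 : (3 * (j - j') + (k + k')) ^ 2 = 0 := by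
    nlinarith [sq_nonneg (2 * (i - i') + (j - j') + (k + k')), sq_nonneg (3 * (j - j') + (k + k')),
      sq_nonneg (k - k')]
  have hk : k = k' := by nlinarith
  have h3 : 3 * (j - j') + (k + k') = 0 := pow_eq_zero_iff (n := 2) (by norm_num) |>.1 h2
  omega

/-- The horizontal slots lie on the twin stacking (layer `0` is a coincidence layer). -/
theorem inPlane_slot_mem_twin {w : EuclideanSpace ℝ (Fin 3)} (hw : w ∈ fccSlots) (hw0 : w 2 = 0) :
    w ∈ barlowStacking 1 (Real.sqrt (2 / 3)) (fun _ : ℤ => (-1 : ℤ)) := by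
  obtain ⟨k, i, j, hkw⟩ := mem_fcc_of_mem_fccSlots hw
  have hw2 : w 2 = (k : ℝ) * Real.sqrt (2 / 3) := by rw [hkw, barlowPos_apply_two]
  have hk : ((k : ℤ) : ℝ) * Real.sqrt (2 / 3) = 0 := by rw [← hw2]; exact hw0
  have hs : Real.sqrt (2 / 3) ≠ 0 := (Real.sqrt_pos.2 (by norm_num)).ne'
  have hk0 : k = 0 := by exact_mod_cast (mul_eq_zero.1 hk).resolve_right hs
  rw [hkw]
  exact (mem_twin_iff_three_dvd k i j).2 ⟨0, by rw [hk0]; ring⟩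

/-- An out-of-plane slot `v` (`v₂ ≠ 0`) and its double `2v` do NOT lie on the twin stacking
(`v` is a site `(±1, i, j)`, and `3 ∤ ±1`, `3 ∤ ±2`). -/
theorem outOfPlane_slot_not_mem_twin {v : EuclideanSpace ℝ (Fin 3)} (hv : v ∈ fccSlots) (hv0 : v 2 ≠ 0) :
    v ∉ barlowStacking 1 (Real.sqrt (2 / 3)) (fun _ : ℤ => (-1 : ℤ)) ∧
      (2 : ℝ) • v ∉ barlowStacking 1 (Real.sqrt (2 / 3)) (fun _ : ℤ => (-1 : ℤ)) := by
  obtain ⟨k, i, j, hkv⟩ := mem_fcc_of_mem_fccSlots hv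
  have hs : 0 < Real.sqrt (2 / 3) := Real.sqrt_pos.2 (by norm_num)
  have hs2 : Real.sqrt (2 / 3) ^ 2 = 2 / 3 := Real.sq_sqrt (by norm_num)
  have hv2 : v 2 = (k : ℝ) * Real.sqrt (2 / 3) := by rw [hkv, barlowPos_apply_two]
  -- `|k| ≤ 1` from `|v₂| ≤ ‖v‖ = 1`, and `k ≠ 0`
  have hk0 : k ≠ 0 := by
    intro h; apply hv0; rw [hv2, h]; simp
  have habs : |v 2| ≤ 1 := by
    have h := abs_apply_sub_le_dist v 0 2
    rw [dist_eq_norm, sub_zero, norm_eq_one_of_mem_fccSlots hv] at h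
    simpa using h
  have hk1 : k ^ 2 ≤ 1 := by
    have h1 : (v 2) ^ 2 ≤ 1 := by
      have := sq_le_sq' (abs_le.1 habs).1 (abs_le.1 habs).2; simpa using this
    rw [hv2, mul_pow, hs2] at h1
    have : ((k : ℤ) : ℝ) ^ 2 ≤ 3 / 2 := by linarith
    have : (k : ℤ) ^ 2 ≤ 1 := by
      by_contra hcon
      push Not at hcon
      have : (2 : ℤ) ≤ k ^ 2 := hcon
      have : (2 : ℝ) ≤ ((k : ℤ) : ℝ) ^ 2 := by exact_mod_cast this
      linarith
    exact this
  have hk' : k = 1 ∨ k = -1 := by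
    have h1 : -1 ≤ k := by nlinarith
    have h2 : k ≤ 1 := by nlinarith
    omega
  have hk3 : ¬ (3 : ℤ) ∣ k := by omega
  have hk6 : ¬ (3 : ℤ) ∣ 2 * k := by omega
  constructor
  · rw [hkv, mem_twin_iff_three_dvd]; exact hk3
  · have e : (2 : ℝ) • v = barlowPos 1 (Real.sqrt (2 / 3)) constHagg (2 * k) (2 * i) (2 * j) := by
      rw [hkv, barlowPos_fcc_linear 1 _ k i j, barlowPos_fcc_linear 1 _ (2 * k) (2 * i) (2 * j)]
      push_cast
      simp only [smul_add, smul_smul]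
    rw [e, mem_twin_iff_three_dvd]; exact hk6

/-- Shifting a site of the moved twin `L·Λ₀⁻ + c` by `L v` (`v ∈ Λ₀`) stays on it iff `v ∈ Λ₀⁻`. -/
theorem add_map_mem_movedTwin_iff
    (L : EuclideanSpace ℝ (Fin 3) ≃ₗᵢ[ℝ] EuclideanSpace ℝ (Fin 3)) (c : EuclideanSpace ℝ (Fin 3))
    {p v : EuclideanSpace ℝ (Fin 3)}
    (hp : p ∈ (fun q => L q + c) '' barlowStacking 1 (Real.sqrt (2 / 3)) (fun _ : ℤ => (-1 : ℤ))) :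
    p + L v ∈ (fun q => L q + c) '' barlowStacking 1 (Real.sqrt (2 / 3)) (fun _ : ℤ => (-1 : ℤ)) ↔
      v ∈ barlowStacking 1 (Real.sqrt (2 / 3)) (fun _ : ℤ => (-1 : ℤ)) := by
  set G := barlowAddSubgroupOfConst 1 (Real.sqrt (2 / 3)) (fun _ : ℤ => (-1 : ℤ)) (fun _ => rfl) with hG
  have hGmem : ∀ q, q ∈ G ↔ q ∈ barlowStacking 1 (Real.sqrt (2 / 3)) (fun _ : ℤ => (-1 : ℤ)) :=
    fun q => Iff.rfl
  obtain ⟨a, ha, rfl⟩ := hp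
  constructor
  · rintro ⟨b, hb, hbe⟩
    have hbe' : L b + c = L a + c + L v := hbe
    have h1 : L (b - a - v) = 0 := by
      have h0 : L b + c - (L a + c + L v) = 0 := sub_eq_zero.2 hbe'
      have e : L (b - a - v) = L b + c - (L a + c + L v) := by simp only [map_sub]; abel
      rw [e]; exact h0
    have h2 : b - a - v = 0 := by
      have := congrArg L.symm h1
      simpa using this
    have hv : v = b - a := (sub_eq_zero.1 h2).symm
    rw [hv]
    exact (hGmem _).1 (G.sub_mem ((hGmem _).2 hb) ((hGmem _).2 ha))
  · intro hv
    refine ⟨a + v, (hGmem _).1 (G.add_mem ((hGmem _).2 ha) ((hGmem _).2 hv)), ?_⟩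
    simp only [map_add]; abel

/-! ## The injection: coincidence run tops ↦ non-coincidence run tops -/

open scoped Classical in
/-- **Coincidence run tops are at most the non-coincidence run tops plus the rim.**  See the module
docstring. -/
theorem csl_card_tops_le_two_mul_nonCoinc
    (L : EuclideanSpace ℝ (Fin 3) ≃ₗᵢ[ℝ] EuclideanSpace ℝ (Fin 3)) (c : EuclideanSpace ℝ (Fin 3))
    (P : Finset (EuclideanSpace ℝ (Fin 3))) (R₀ ρ : ℝ) (hR₀ : 3 ≤ R₀) (hρ : R₀ ≤ ρ)
    (hP : ∀ p, p ∈ P ↔ (p ∈ (fun q => L q + c) '' fccStacking 1 (Real.sqrt (2 / 3)) ∧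
      -(2 * R₀) ≤ p 2 ∧ p 2 ≤ -R₀ ∧ p 0 ^ 2 + p 1 ^ 2 ≤ ρ ^ 2))
    {w : EuclideanSpace ℝ (Fin 3)} (hw : w ∈ fccSlots) (hw0 : w 2 = 0) :
    (P.filter fun p => p + L w ∉ P).card ≤
      2 * (P.filter fun p => p ∉ (fun q => L q + c) '' barlowStacking 1 (Real.sqrt (2 / 3))
          (fun _ : ℤ => (-1 : ℤ)) ∧ p + L w ∉ P).card +
        (P.filter fun p => (ρ - 2) ^ 2 < p 0 ^ 2 + p 1 ^ 2).card := by
  classical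
  set e₃ : EuclideanSpace ℝ (Fin 3) := EuclideanSpace.single (2 : Fin 3) (1 : ℝ) with he₃
  set Λ₁ : Set (EuclideanSpace ℝ (Fin 3)) := (fun q => L q + c) '' fccStacking 1 (Real.sqrt (2 / 3)) with hΛ₁
  set Λ₂ : Set (EuclideanSpace ℝ (Fin 3)) :=
    (fun q => L q + c) '' barlowStacking 1 (Real.sqrt (2 / 3)) (fun _ : ℤ => (-1 : ℤ)) with hΛ₂
  set G := barlowAddSubgroupOfConst 1 (Real.sqrt (2 / 3)) (fun _ : ℤ => (-1 : ℤ)) (fun _ => rfl) with hG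
  have hGmem : ∀ q, q ∈ G ↔ q ∈ barlowStacking 1 (Real.sqrt (2 / 3)) (fun _ : ℤ => (-1 : ℤ)) :=
    fun q => Iff.rfl
  have hρ2 : (0 : ℝ) ≤ ρ - 2 := by linarith
  have hwΛ : w ∈ fccStacking 1 (Real.sqrt (2 / 3)) := mem_fcc_of_mem_fccSlots hw
  have hwtwin := inPlane_slot_mem_twin hw hw0
  have hLw0 : L w ≠ 0 := by
    intro h0
    have : ‖L w‖ = 0 := by rw [h0, norm_zero]
    rw [LinearIsometryEquiv.norm_map, norm_eq_one_of_mem_fccSlots hw] at this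
    norm_num at this
  -- multiples of `w` stay on / off the twin
  have hnw : ∀ n : ℕ, ((n : ℕ) : ℝ) • w ∈ barlowStacking 1 (Real.sqrt (2 / 3)) (fun _ : ℤ => (-1 : ℤ)) := by
    intro n
    rw [Nat.cast_smul_eq_nsmul ℝ]
    exact (hGmem _).1 (G.nsmul_mem ((hGmem _).2 hwtwin) n)
  have hshift_notMem : ∀ q, q ∈ Λ₁ → q ∉ Λ₂ → ∀ n : ℕ, q + ((n : ℕ) : ℝ) • L w ∉ Λ₂ := by
    intro q hq hq2 n hmem
    apply hq2
    have e : q = (q + ((n : ℕ) : ℝ) • L w) + L (-(((n : ℕ) : ℝ) • w)) := by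
      rw [map_neg, LinearIsometryEquiv.map_smul]; abel
    rw [e]
    exact (add_map_mem_movedTwin_iff L c hmem).2
      ((hGmem _).1 (G.neg_mem ((hGmem _).2 (hnw n))))
  -- the out-of-plane slot `vp` with `⟪L vp, e₃⟫ ≥ 0`
  obtain ⟨vp, hvp, hvp0, hvpup⟩ : ∃ v ∈ fccSlots, v 2 ≠ 0 ∧ 0 ≤ ⟪L v, e₃⟫_ℝ := by
    set t : EuclideanSpace ℝ (Fin 3) := barlowPos 1 (Real.sqrt (2 / 3)) constHagg 1 0 0 with ht
    have htΛ : t ∈ fccStacking 1 (Real.sqrt (2 / 3)) := barlowPos_mem _ _ _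
    have ht2 : t 2 ≠ 0 := by
      rw [ht, barlowPos_apply_two]; push_cast; rw [one_mul]
      exact (Real.sqrt_pos.2 (by norm_num)).ne'
    have htn : ‖t‖ = 1 := norm_barlowPos_fcc_eq_one (by norm_num)
    have hts : t ∈ fccSlots := mem_fccSlots_of_unit htΛ htn
    rcases le_or_gt 0 ⟪L t, e₃⟫_ℝ with h | h
    · exact ⟨t, hts, ht2, h⟩
    · refine ⟨-t, neg_mem_fccSlots hts, by simpa using ht2, ?_⟩
      rw [map_neg, inner_neg_left]; linarith
  obtain ⟨hvptwin, hvptwin2⟩ := outOfPlane_slot_not_mem_twin hvp hvp0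
  have hvpΛ : vp ∈ fccStacking 1 (Real.sqrt (2 / 3)) := mem_fcc_of_mem_fccSlots hvp
  have hαv : ⟪L vp, e₃⟫_ℝ ≤ 1 := (abs_le.1 (abs_inner_slot_le_one L hvp)).2
  -- the three families
  set Tall := P.filter fun p => p + L w ∉ P with hTall
  set Tn := P.filter fun p => p ∉ Λ₂ ∧ p + L w ∉ P with hTn
  set Rim := P.filter fun p => (ρ - 2) ^ 2 < p 0 ^ 2 + p 1 ^ 2 with hRim
  set Tc := P.filter fun p => p ∈ Λ₂ ∧ p + L w ∉ P ∧ p 0 ^ 2 + p 1 ^ 2 ≤ (ρ - 2) ^ 2 with hTc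
  have hcover : Tall ⊆ Tn ∪ (Tc ∪ Rim) := by
    intro p hp
    rw [hTall, mem_filter] at hp
    rw [mem_union, mem_union, hTn, hTc, hRim, mem_filter, mem_filter, mem_filter]
    by_cases h2 : p ∈ Λ₂
    · by_cases hr : (ρ - 2) ^ 2 < p 0 ^ 2 + p 1 ^ 2
      · exact Or.inr (Or.inr ⟨hp.1, hr⟩)
      · push Not at hr; exact Or.inr (Or.inl ⟨hp.1, h2, hp.2, hr⟩)
    · exact Or.inl ⟨hp.1, h2, hp.2⟩
  -- the shifted point `q(p) = p ± L vp` is in `P`, on `Λ₁`, off `Λ₂`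
  set σ : EuclideanSpace ℝ (Fin 3) → ℝ := fun p => if p 2 ≤ -R₀ - 1 then 1 else -1 with hσ
  set qf : EuclideanSpace ℝ (Fin 3) → EuclideanSpace ℝ (Fin 3) := fun p => p + σ p • L vp with hqf
  have hσv : ∀ p, σ p • L vp = L (σ p • vp) := by
    intro p; rw [LinearIsometryEquiv.map_smul]
  have hσΛ : ∀ p, σ p • vp ∈ fccStacking 1 (Real.sqrt (2 / 3)) := by
    intro p
    simp only [hσ]
    split_ifs
    · rw [one_smul]; exact hvpΛ
    · rw [neg_one_smul]; exact fcc_neg_mem hvpΛ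
  have hσtwin : ∀ p, σ p • vp ∉ barlowStacking 1 (Real.sqrt (2 / 3)) (fun _ : ℤ => (-1 : ℤ)) := by
    intro p
    simp only [hσ]
    split_ifs
    · rw [one_smul]; exact hvptwin
    · rw [neg_one_smul]
      intro h
      exact hvptwin (by simpa using (hGmem _).1 (G.neg_mem ((hGmem _).2 h)))
  have hq : ∀ p ∈ Tc, qf p ∈ P ∧ qf p ∉ Λ₂ := by
    intro p hp
    rw [hTc, mem_filter] at hp
    obtain ⟨hpP, hp2, -, hprim⟩ := hp
    obtain ⟨hpΛ, hz1, hz2, hlat⟩ := (hP p).1 hpP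
    have hmemΛ₁ : qf p ∈ Λ₁ := by
      simp only [hqf]; rw [hσv]; exact movedFcc_add_site_mem L c hpΛ (hσΛ p)
    have hnot : qf p ∉ Λ₂ := by
      simp only [hqf]; rw [hσv]
      intro h
      exact hσtwin p ((add_map_mem_movedTwin_iff L c hp2).1 h)
    -- lateral radius
    have hsp : Real.sqrt (p 0 ^ 2 + p 1 ^ 2) ≤ ρ - 2 := by
      rw [← Real.sqrt_sq hρ2]; exact Real.sqrt_le_sqrt hprim
    have hlatq : (qf p) 0 ^ 2 + (qf p) 1 ^ 2 ≤ ρ ^ 2 := by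
      have h1 := sqrt_lateral_add_le p (σ p • L vp)
      have hn : ‖σ p • L vp‖ = 1 := by
        rw [norm_smul, LinearIsometryEquiv.norm_map, norm_eq_one_of_mem_fccSlots hvp, mul_one,
          Real.norm_eq_abs]
        simp only [hσ]; split_ifs <;> simp
      rw [hn] at h1
      have h2 : Real.sqrt ((qf p) 0 ^ 2 + (qf p) 1 ^ 2) ≤ ρ := by simp only [hqf]; linarith
      have h3 := Real.sq_sqrt (by positivity : (0 : ℝ) ≤ (qf p) 0 ^ 2 + (qf p) 1 ^ 2)
      nlinarith [Real.sqrt_nonneg ((qf p) 0 ^ 2 + (qf p) 1 ^ 2)]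
    -- height
    have hzq : (qf p) 2 = p 2 + σ p * ⟪L vp, e₃⟫_ℝ := by
      simp only [hqf]
      rw [PiLp.add_apply, PiLp.smul_apply, smul_eq_mul, apply_two_eq_inner_e₃ (L vp)]
    have hwin : -(2 * R₀) ≤ (qf p) 2 ∧ (qf p) 2 ≤ -R₀ := by
      rw [hzq]
      simp only [hσ]
      split_ifs with hlow
      · constructor <;> nlinarith
      · push Not at hlow
        constructor <;> nlinarith
    exact ⟨(hP _).2 ⟨hmemΛ₁, hwin.1, hwin.2, hlatq⟩, hnot⟩
  -- the run top above `q(p)`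
  have key : ∀ p ∈ Tc, ∃ m : ℕ, qf p + ((m : ℕ) : ℝ) • L w ∈ P ∧
      qf p + ((m + 1 : ℕ) : ℝ) • L w ∉ P := by
    intro p hp
    obtain ⟨m, h1, h2, -⟩ := exists_runTop P (qf p) (L w) hLw0 (hq p hp).1
    exact ⟨m, h1, h2⟩
  choose! m hm using key
  set Gf : EuclideanSpace ℝ (Fin 3) → EuclideanSpace ℝ (Fin 3) :=
    fun p => qf p + ((m p : ℕ) : ℝ) • L w with hGf
  have hconv := runConvex_clampedSample L c (-(2 * R₀)) (-R₀) ρ (by linarith) P hP hwΛ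
  -- `Gf` maps `Tc` into `Tn`
  have hmaps : ∀ p ∈ Tc, Gf p ∈ Tn := by
    intro p hp
    obtain ⟨h1, h2⟩ := hm p hp
    obtain ⟨hqP, hq2⟩ := hq p hp
    rw [hTn, mem_filter]
    refine ⟨h1, hshift_notMem _ ((hP _).1 hqP).1 hq2 (m p), ?_⟩
    have e : Gf p + L w = qf p + ((m p + 1 : ℕ) : ℝ) • L w := by
      simp only [hGf]; push_cast; rw [add_smul, one_smul, add_assoc]
    rw [e]; exact h2
  -- `Gf` is injective on `Tc`
  have hinj : Set.InjOn Gf ↑Tc := by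
    intro p hp p' hp' hGG
    have hpc := hp; have hpc' := hp'
    rw [Finset.mem_coe, hTc, mem_filter] at hpc hpc'
    obtain ⟨hpP, hp2, hptop, -⟩ := hpc
    obtain ⟨hp'P, hp'2, hp'top, -⟩ := hpc'
    have hGG' : p + σ p • L vp + ((m p : ℕ) : ℝ) • L w = p' + σ p' • L vp + ((m p' : ℕ) : ℝ) • L w :=
      hGG
    by_cases hs : σ p = σ p'
    · -- same sign: same line, one top per line
      have h1 : p + ((m p : ℕ) : ℝ) • L w = p' + ((m p' : ℕ) : ℝ) • L w := by
        calc p + ((m p : ℕ) : ℝ) • L w = (p + σ p • L vp + ((m p : ℕ) : ℝ) • L w) - σ p • L vp := by abel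
          _ = (p' + σ p' • L vp + ((m p' : ℕ) : ℝ) • L w) - σ p' • L vp := by rw [hGG', hs]
          _ = p' + ((m p' : ℕ) : ℝ) • L w := by abel
      rcases lt_trichotomy (m p) (m p') with hlt | heq | hgt
      · -- `p = p' + (d+1) • L w`: then `p' + L w ∈ P`, contradiction
        exfalso
        obtain ⟨d, hd⟩ : ∃ d : ℕ, m p' = m p + d + 1 := ⟨m p' - m p - 1, by omega⟩
        have hpd : p = p' + ((d + 1 : ℕ) : ℝ) • L w := by
          rw [hd] at h1
          push_cast at h1 ⊢
          calc p = (p + ((m p : ℕ) : ℝ) • L w) - ((m p : ℕ) : ℝ) • L w := by module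
            _ = (p' + (((m p : ℕ) : ℝ) + (d : ℝ) + 1) • L w) - ((m p : ℕ) : ℝ) • L w := by rw [h1]
            _ = p' + ((d : ℝ) + 1) • L w := by module
        have h2 : p' + ((1 : ℕ) : ℝ) • L w ∈ P :=
          hconv p' hp'P (d + 1) (by rw [← hpd]; exact hpP) 1 (by omega)
        rw [Nat.cast_one, one_smul] at h2
        exact hp'top h2
      · calc p = (p + ((m p : ℕ) : ℝ) • L w) - ((m p : ℕ) : ℝ) • L w := by abel
          _ = (p' + ((m p' : ℕ) : ℝ) • L w) - ((m p : ℕ) : ℝ) • L w := by rw [h1]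
          _ = p' := by rw [heq]; abel
      · exfalso
        obtain ⟨d, hd⟩ : ∃ d : ℕ, m p = m p' + d + 1 := ⟨m p - m p' - 1, by omega⟩
        have hpd : p' = p + ((d + 1 : ℕ) : ℝ) • L w := by
          rw [hd] at h1
          push_cast at h1 ⊢
          calc p' = (p' + ((m p' : ℕ) : ℝ) • L w) - ((m p' : ℕ) : ℝ) • L w := by module
            _ = (p + (((m p' : ℕ) : ℝ) + (d : ℝ) + 1) • L w) - ((m p' : ℕ) : ℝ) • L w := by rw [h1]
            _ = p + ((d : ℝ) + 1) • L w := by module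
        have h2 : p + ((1 : ℕ) : ℝ) • L w ∈ P :=
          hconv p hpP (d + 1) (by rw [← hpd]; exact hp'P) 1 (by omega)
        rw [Nat.cast_one, one_smul] at h2
        exact hptop h2
    · -- different signs: the difference is `L((σ p − σ p') vp + n w)` on `Λ₀⁻`, forcing `2 vp ∈ Λ₀⁻`
      exfalso
      have hσvals : ∀ x, σ x = 1 ∨ σ x = -1 := by
        intro x; simp only [hσ]; split_ifs <;> simp
      have hdiff : σ p - σ p' = 2 ∨ σ p - σ p' = -2 := by
        rcases hσvals p with h1 | h1 <;> rcases hσvals p' with h2 | h2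
        · exact absurd (h1.trans h2.symm) hs
        · left; rw [h1, h2]; norm_num
        · right; rw [h1, h2]; norm_num
        · exact absurd (h1.trans h2.symm) hs
      have hvec : p' = p + L ((σ p - σ p') • vp + (((m p : ℕ) : ℝ) - ((m p' : ℕ) : ℝ)) • w) := by
        rw [map_add, LinearIsometryEquiv.map_smul, LinearIsometryEquiv.map_smul]
        calc p' = (p' + σ p' • L vp + ((m p' : ℕ) : ℝ) • L w) - σ p' • L vp - ((m p' : ℕ) : ℝ) • L w := by
              module
          _ = (p + σ p • L vp + ((m p : ℕ) : ℝ) • L w) - σ p' • L vp - ((m p' : ℕ) : ℝ) • L w := by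
              rw [hGG']
          _ = p + ((σ p - σ p') • L vp + (((m p : ℕ) : ℝ) - ((m p' : ℕ) : ℝ)) • L w) := by module
      have hmemv : (σ p - σ p') • vp + (((m p : ℕ) : ℝ) - ((m p' : ℕ) : ℝ)) • w ∈
          barlowStacking 1 (Real.sqrt (2 / 3)) (fun _ : ℤ => (-1 : ℤ)) :=
        (add_map_mem_movedTwin_iff L c hp2).1 (by rw [← hvec]; exact hp'2)
      have hmw : (((m p : ℕ) : ℝ) - ((m p' : ℕ) : ℝ)) • w ∈
          barlowStacking 1 (Real.sqrt (2 / 3)) (fun _ : ℤ => (-1 : ℤ)) := by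
        rw [sub_smul]
        exact (hGmem _).1 (G.sub_mem ((hGmem _).2 (hnw _)) ((hGmem _).2 (hnw _)))
      have h2v : (σ p - σ p') • vp ∈ barlowStacking 1 (Real.sqrt (2 / 3)) (fun _ : ℤ => (-1 : ℤ)) := by
        have := G.sub_mem ((hGmem _).2 hmemv) ((hGmem _).2 hmw)
        rw [add_sub_cancel_right] at this
        exact (hGmem _).1 this
      rcases hdiff with h | h
      · rw [h] at h2v; exact hvptwin2 h2v
      · rw [h, neg_smul] at h2v
        exact hvptwin2 (by simpa using (hGmem _).1 (G.neg_mem ((hGmem _).2 h2v)))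
  -- count
  have hTc_le : Tc.card ≤ Tn.card := Finset.card_le_card_of_injOn Gf hmaps hinj
  calc Tall.card ≤ (Tn ∪ (Tc ∪ Rim)).card := card_le_card hcover
    _ ≤ Tn.card + (Tc ∪ Rim).card := card_union_le _ _
    _ ≤ Tn.card + (Tc.card + Rim.card) := by gcongr; exact card_union_le _ _
    _ ≤ 2 * Tn.card + Rim.card := by omega

end Summit.Ventures.Crystal3D.Theorems

end
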